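import Mathlib.Analysis.InnerProductSpace.PiL2
import Literature.Analysis.FluidPDE.HardSphereDynamics
import HarnessLib

/-!
# Diced hard-sphere dynamics: hard spheres whose scattering is steered by internal rotors

The *rotor gas* `HS_rot(Ω, D)` of the route `Summits/AtomisticToContinuum/HydrodynamicLimit/
Theses/AnosovRotorDice` (idea card `anosov-rotor-spheres`; items `RotorDiceHopf`,
`RotorGasEulerLimit`, `OneSphereHopfToMaxwellian`): `N` hard spheres of diameter `ε` in `ℝ³`/`𝕋³`
(`Literature.Analysis.FluidPDE.Config N (Fin 3) X`, `HardSpherePhaseSpace.lean`), each carrying an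
internal *rotor* state `θ_i ∈ K`. Between contacts the centres move by free flight and the rotors by
an autonomous flow `θ ↦ D.g (Ω t) θ`; at a contact of the (ordered) pair `i < j` with unit normal
`ω = (x_i - x_j)/|x_i - x_j|` and incoming relative velocity `g = v_i - v_j` (`⟪g, ω⟫ < 0`) the pair
keeps its centre-of-mass velocity and `|g|` and leaves with the relative velocity
`g' = |g| · Λ_ω⁻¹ (D.F θ_i θ_j (Λ_ω (S_ω g / |g|)))`, where `S_ω g = g - 2⟪g, ω⟫ ω` is the specular
reflection and `Λ_ω : {n ∈ S² | ⟪n, ω⟫ > 0} → {q ∈ ω^⊥ | |q| < 1}`, `n ↦ n - ⟪n, ω⟫ ω`, is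
Lambert's projection of the outgoing hemisphere onto the unit disc of `ω^⊥ ≅ ℝ²`; rotors are
untouched at contacts. `D.F θ θ' : ℝ² → ℝ²` is the *die*: it is meant to be an area-preserving
bijection of the closed unit disc (identity near the unit circle), and since `Λ_ω` pushes the flux
(Knudsen cosine) measure `⟪n, ω⟫ dσ(n)` of the hemisphere (Cook–Feres 2012 §1) to Lebesgue measure
on the disc, such a die makes the boundary collision map flux-preserving, whence
`Liouville ⊗ m^{⊗N}` is invariant — the design reason for the Lambert disc. `F ≡ id` is the elastic
hard-sphere gas: `dicedReflectVel_id`, `dicedCollidePair_id`.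

## Contents

* `Lambert.e₁/e₂/frame/coords/embed/lift`: an explicit measurable orthonormal frame
  `(e₁ ω, e₂ ω, ω)` of `ℝ³` for unit `ω` (polar frame, fallback at the poles; `orthonormal_frame`),
  the Lambert disc coordinates `coords ω : ℝ³ → ℝ²` and their inverse `lift ω` on the hemisphere.
  The die acts on `ℝ²`, so SOME frame of `ω^⊥` must be fixed; the rule is frame-independent
  exactly for `O(2)`-equivariant dice, otherwise the frame is part of the model (stated, not
  hidden).
* `lambertPoint`, `dicedRelVel`, `dicedReflectVel`: the pair rule; momentum and energy
  conservation (`dicedReflectVel_fst_add_snd`, `norm_sq_dicedReflectVel`), the specular case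
  (`dicedReflectVel_id`) and TIME REVERSAL (`dicedRelVel_reverse`, `dicedReflectVel_reverse`): the
  reversed collision undoes the forward one iff the dice satisfy `F' (-(F q)) = -q`, i.e. the
  conjugating involution of the disc is the central inversion `C = -id` (`RotorDie.IsReversible`).
* `dicedCollidePair G i j A z`: the rule on configurations (positions unchanged, other particles
  unchanged); `RotorDie K` = the dynamical data `(m, g, F, ι)` of a die on a measurable rotor space
  `K` (the INTERFACE `AnosovDie` of `Literature/Dynamics/Hyperbolic`, definition request
  `defn-AnosovDie`, supplies such data plus hyperbolicity axioms; only the data is needed here);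
  `DicedConfig N X K = Config N (Fin 3) X × (Fin N → K)`; `rotorFlight`, `dicedCollide`.
* `IsDicedHardSphereTrajectory G ε N D Ω γ` and the hypothesis structure
  `DicedHardSphereFlow G ε N D Ω` mirroring `IsHardSphereTrajectory` / `HardSphereFlow`
  (`HardSphereDynamics.lean`; GST 2013 §4.1, Alexander 1975) with the reference measure
  `dicedLiouville G N ε D = liouville G N ε ⊗ ⨂_{i<N} D.m`; API `lawAt`, `transportDensity`,
  `transportFn`, `withRotors` (`P ↦ P ⊗ m^{⊗N}`, e.g. local Gibbs ⊗ `m^{⊗N}`), `configFlow`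
  (forget the rotors, for the empirical hydrodynamic fields), `dicedTimeReverse`.

## Design choices

* `d = 3` only (the disc is `2`-dimensional). The frame `Lambert.e₁/e₂` is Borel but discontinuous
  at the poles `ω = ±(0,0,1)` (hairy ball); everything downstream is measure-theoretic.
* `Λ_ω (S_ω g/|g|) = coords ω g / |g|`: Lambert's projection forgets the normal component, so the
  specular step is invisible in the formula (`lambertPoint`); it reappears in `dicedReflectVel_id`.
* The contact rule is attached to ORDERED pairs `i < j` (`IsDicedHardSphereTrajectory.binary`):
  the die `F θ_i θ_j` and the frame at `ω` versus `-ω` are not symmetric under `i ↔ j` (for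
  `F ≡ id` the rule is symmetric and agrees with `collidePair`, which is).
* Rotors are autonomous (`rotor` field: `θ(t) = D.g (Ω (t - s)) θ(s)` for all `s ≤ t`), so no
  topology on `K` is needed: left limits are taken of the translational component only.
* `DicedHardSphereFlow` is a structure of hypotheses (as `HardSphereFlow`): its EXISTENCE on `𝕋³`
  for `0 < ε < 1/2` and an admissible die (Alexander's argument: the collision map is a smooth
  flux-preserving bijection off grazing) is the route's separate support statement
  `∀ N, Nonempty (DicedHardSphereFlow (Torus.geometry (Fin 3)) ε N D Ω)`; it is NOT a published
  theorem and is deliberately not vendored here as a named fact.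
* Junk values: `lambertPoint ω 0 = 0`, `Lambert.lift` of a point outside the closed disc uses
  `Real.sqrt` of a negative number (`= 0`); the rule is only ever applied to incoming pairs.

## References

* I. Gallagher, L. Saint-Raymond, B. Texier, *From Newton to Boltzmann* (2013), §4.1 (hard-sphere
  trajectories, Prop. 4.1.1, Def. 4.1.2). R. K. Alexander, PhD thesis, Berkeley (1975).
* C. Cercignani, R. Illner, M. Pulvirenti, *The Mathematical Theory of Dilute Gases* (1994), §4.2
  (time reversal).
* S. Cook, R. Feres, *Random billiards with wall temperature and associated Markov chains*,
  Nonlinearity 25 (2012), §1: the Knudsen cosine law `⟪n, ω⟫ dσ` as the invariant flux measure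
  of (random or deterministic) reflection laws; R. Feres, H.-K. Zhang, CMP 313 (2012).
* The model: idea card `anosov-rotor-spheres` and its triage (flux flaw of the linear rule
  `R(θ, θ') ∘ S_ω`, repaired by the Lambert-disc rule formalised here), route `AnosovRotorDice`.
-/

open MeasureTheory Set Filter
open scoped InnerProductSpace ENNReal Topology

namespace Literature.Analysis.FluidPDE

noncomputable section

local notation "E²" => EuclideanSpace ℝ (Fin 2)
local notation "E³" => EuclideanSpace ℝ (Fin 3)

/-! ## Lambert coordinates on the outgoing hemisphere -/

namespace Lambert

/-- The cylindrical radius `ρ(ω) = √(ω₀² + ω₁²)` of a vector of `ℝ³` (distance to the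
`x₂`-axis); it vanishes exactly at the two poles `ω = ± e₂` of the unit sphere. [folklore] -/
def rho (ω : E³) : ℝ := √(ω 0 ^ 2 + ω 1 ^ 2)

/-- First leg of the polar frame of `ω^⊥`: the unit vector `(-ω₁, ω₀, 0)/ρ(ω)` along the circle
of latitude through `ω`, and `(1, 0, 0)` at the poles `ρ(ω) = 0` (a measurable, not continuous,
frame field on `S²`; hairy-ball forbids a continuous one). [folklore] -/
def e₁ (ω : E³) : E³ :=
  if rho ω = 0 then !₂[1, 0, 0] else !₂[-ω 1 / rho ω, ω 0 / rho ω, 0]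

/-- Second leg of the polar frame of `ω^⊥`: `e₂ = ω × e₁ = (-ω₀ω₂, -ω₁ω₂, ρ²)/ρ` (the meridian
direction), and `(0, ω₂, 0)` at the poles; `(e₁ ω, e₂ ω, ω)` is a positively oriented
orthonormal basis of `ℝ³` for every unit `ω` (`Lambert.orthonormal_frame`). [folklore] -/
def e₂ (ω : E³) : E³ :=
  if rho ω = 0 then !₂[0, ω 2, 0] else !₂[-(ω 0 * ω 2) / rho ω, -(ω 1 * ω 2) / rho ω, rho ω]

/-- The frame `(e₁ ω, e₂ ω, ω)` as a `Fin 3`-indexed family. [folklore] -/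
def frame (ω : E³) : Fin 3 → E³ := ![e₁ ω, e₂ ω, ω]

/-- Frame coordinates of the orthogonal projection onto `ω^⊥`:
`coords ω x = (⟪e₁ ω, x⟫, ⟪e₂ ω, x⟫) ∈ ℝ²`. On the unit sphere this is **Lambert's (orthographic
polar) projection** `n ↦ n - ⟪n, ω⟫ ω` of the hemisphere `{n | 0 < ⟪n, ω⟫}` onto the open unit disc
of `ω^⊥ ≅ ℝ²`, which pushes the flux (Knudsen cosine) measure `⟪n, ω⟫ dσ(n)` forward to Lebesgue
measure on the disc. [folklore] -/
def coords (ω x : E³) : E² := !₂[⟪e₁ ω, x⟫_ℝ, ⟪e₂ ω, x⟫_ℝ]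

/-- The isometric embedding `ℝ² ≅ ω^⊥ ⊆ ℝ³`, `q ↦ q₀ e₁ ω + q₁ e₂ ω`. [folklore] -/
def embed (ω : E³) (q : E²) : E³ := q 0 • e₁ ω + q 1 • e₂ ω

/-- The inverse Lambert projection: the point `embed ω q + √(1 - |q|²) ω` of the closed hemisphere
`{n ∈ S² | 0 ≤ ⟪n, ω⟫}` above the disc point `q`, `|q| ≤ 1` (junk for `|q| > 1`, where
`Real.sqrt` vanishes). [folklore] -/
def lift (ω : E³) (q : E²) : E³ := embed ω q + √(1 - ‖q‖ ^ 2) • ω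

variable {ω : E³}

/-- Coordinate formula for the inner product of `ℝ³`. [folklore] -/
private theorem inner_three (x y : E³) : ⟪x, y⟫_ℝ = x 0 * y 0 + x 1 * y 1 + x 2 * y 2 := by
  rw [EuclideanSpace.inner_eq_star_dotProduct, star_trivial, dotProduct, Fin.sum_univ_three]
  ring

/-- Coordinate formula for the squared norm of `ℝ³`. [folklore] -/
private theorem norm_sq_three (x : E³) : ‖x‖ ^ 2 = x 0 ^ 2 + x 1 ^ 2 + x 2 ^ 2 := by
  rw [EuclideanSpace.real_norm_sq_eq, Fin.sum_univ_three]

/-- Coordinate formula for the squared norm of `ℝ²`. [folklore] -/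
private theorem norm_sq_two (q : E²) : ‖q‖ ^ 2 = q 0 ^ 2 + q 1 ^ 2 := by
  rw [EuclideanSpace.real_norm_sq_eq, Fin.sum_univ_two]

/-- A unit vector of `ℝ³` has coordinate squares summing to `1`. [folklore] -/
private theorem sum_sq_eq_one (hω : ‖ω‖ = 1) : ω 0 ^ 2 + ω 1 ^ 2 + ω 2 ^ 2 = 1 := by
  rw [← norm_sq_three, hω, one_pow]

/-- `ρ(ω)² = ω₀² + ω₁²`. [folklore] -/
private theorem rho_sq : rho ω ^ 2 = ω 0 ^ 2 + ω 1 ^ 2 :=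
  Real.sq_sqrt (by positivity)

/-- At the poles `ρ(ω) = 0` the first two coordinates vanish. [folklore] -/
private theorem eq_zero_of_rho_eq_zero (h : rho ω = 0) : ω 0 = 0 ∧ ω 1 = 0 := by
  have h2 : ω 0 ^ 2 + ω 1 ^ 2 = 0 := by rw [← rho_sq, h]; ring
  constructor <;> nlinarith [sq_nonneg (ω 0), sq_nonneg (ω 1)]

/-- `e₁ ω` is a unit vector. [folklore] -/
theorem inner_e₁_e₁ (ω : E³) : ⟪e₁ ω, e₁ ω⟫_ℝ = 1 := by
  unfold e₁
  split_ifs with h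
  · rw [inner_three]
    simp
  · have hρ := rho_sq (ω := ω)
    rw [inner_three]
    simp only [Matrix.cons_val_zero, Matrix.cons_val_one, Matrix.cons_val_two,
      Matrix.head_cons, Matrix.tail_cons]
    field_simp
    linarith

/-- `e₂ ω` is a unit vector (for unit `ω`). [folklore] -/
theorem inner_e₂_e₂ (hω : ‖ω‖ = 1) : ⟪e₂ ω, e₂ ω⟫_ℝ = 1 := by
  have h1 := sum_sq_eq_one hω
  unfold e₂
  split_ifs with h
  · obtain ⟨h0, h1'⟩ := eq_zero_of_rho_eq_zero h
    rw [inner_three]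
    simp only [Matrix.cons_val_zero, Matrix.cons_val_one, Matrix.cons_val_two,
      Matrix.head_cons, Matrix.tail_cons]
    nlinarith
  · have hρ := rho_sq (ω := ω)
    rw [inner_three]
    simp only [Matrix.cons_val_zero, Matrix.cons_val_one, Matrix.cons_val_two,
      Matrix.head_cons, Matrix.tail_cons]
    have e : -(ω 0 * ω 2) / rho ω * (-(ω 0 * ω 2) / rho ω) +
        -(ω 1 * ω 2) / rho ω * (-(ω 1 * ω 2) / rho ω) + rho ω * rho ω =
        ω 2 ^ 2 * (ω 0 ^ 2 + ω 1 ^ 2) / rho ω ^ 2 + rho ω ^ 2 := by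
      field_simp
    rw [e, ← hρ, mul_div_assoc, div_self (pow_ne_zero 2 h), mul_one, hρ]
    linarith

/-- `e₁ ω ⟂ e₂ ω`. [folklore] -/
theorem inner_e₁_e₂ (ω : E³) : ⟪e₁ ω, e₂ ω⟫_ℝ = 0 := by
  unfold e₁ e₂
  split_ifs with h
  · rw [inner_three]
    simp
  · rw [inner_three]
    simp only [Matrix.cons_val_zero, Matrix.cons_val_one, Matrix.cons_val_two,
      Matrix.head_cons, Matrix.tail_cons]
    field_simp
    ring

/-- `e₂ ω ⟂ e₁ ω`. [folklore] -/
theorem inner_e₂_e₁ (ω : E³) : ⟪e₂ ω, e₁ ω⟫_ℝ = 0 := by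
  rw [real_inner_comm]; exact inner_e₁_e₂ ω

/-- `e₁ ω ⟂ ω`. [folklore] -/
theorem inner_e₁_self (ω : E³) : ⟪e₁ ω, ω⟫_ℝ = 0 := by
  unfold e₁
  split_ifs with h
  · obtain ⟨h0, -⟩ := eq_zero_of_rho_eq_zero h
    rw [inner_three]
    simp [h0]
  · rw [inner_three]
    simp only [Matrix.cons_val_zero, Matrix.cons_val_one, Matrix.cons_val_two,
      Matrix.head_cons, Matrix.tail_cons]
    field_simp
    ring

/-- `e₂ ω ⟂ ω`. [folklore] -/
theorem inner_e₂_self (ω : E³) : ⟪e₂ ω, ω⟫_ℝ = 0 := by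
  unfold e₂
  split_ifs with h
  · obtain ⟨h0, h1⟩ := eq_zero_of_rho_eq_zero h
    rw [inner_three]
    simp [h0, h1]
  · have hρ := rho_sq (ω := ω)
    rw [inner_three]
    simp only [Matrix.cons_val_zero, Matrix.cons_val_one, Matrix.cons_val_two,
      Matrix.head_cons, Matrix.tail_cons]
    have e : -(ω 0 * ω 2) / rho ω * ω 0 + -(ω 1 * ω 2) / rho ω * ω 1 + rho ω * ω 2 =
        -(ω 2) * (ω 0 ^ 2 + ω 1 ^ 2) / rho ω + rho ω * ω 2 := by
      field_simp
      ring
    rw [e, ← hρ]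
    field_simp
    ring

/-- `ω ⟂ e₁ ω`. [folklore] -/
theorem inner_self_e₁ (ω : E³) : ⟪ω, e₁ ω⟫_ℝ = 0 := by
  rw [real_inner_comm]; exact inner_e₁_self ω

/-- `ω ⟂ e₂ ω`. [folklore] -/
theorem inner_self_e₂ (ω : E³) : ⟪ω, e₂ ω⟫_ℝ = 0 := by
  rw [real_inner_comm]; exact inner_e₂_self ω

/-- `|e₁ ω| = 1`. [folklore] -/
@[simp]
theorem norm_e₁ (ω : E³) : ‖e₁ ω‖ = 1 := by
  rw [← Real.sqrt_sq (norm_nonneg _), ← real_inner_self_eq_norm_sq, inner_e₁_e₁ ω, Real.sqrt_one]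

/-- `|e₂ ω| = 1` (unit `ω`). [folklore] -/
@[simp]
theorem norm_e₂ (hω : ‖ω‖ = 1) : ‖e₂ ω‖ = 1 := by
  rw [← Real.sqrt_sq (norm_nonneg _), ← real_inner_self_eq_norm_sq, inner_e₂_e₂ hω, Real.sqrt_one]

/-- For a unit vector `ω`, `(e₁ ω, e₂ ω, ω)` is an orthonormal family. [folklore] -/
theorem orthonormal_frame (hω : ‖ω‖ = 1) : Orthonormal ℝ (frame ω) := by
  rw [orthonormal_iff_ite]
  intro i j
  fin_cases i <;> fin_cases j <;>
    simp [frame, norm_e₂ hω, hω, inner_e₁_e₂, inner_e₂_e₁, inner_e₁_self,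
      inner_e₂_self, inner_self_e₁, inner_self_e₂]

/-- The frame as an orthonormal basis of `ℝ³` (unit `ω`). [folklore] -/
def frameBasis (hω : ‖ω‖ = 1) : OrthonormalBasis (Fin 3) ℝ E³ :=
  (basisOfOrthonormalOfCardEqFinrank (orthonormal_frame hω)
    (by rw [finrank_euclideanSpace_fin, Fintype.card_fin])).toOrthonormalBasis
    (by rw [coe_basisOfOrthonormalOfCardEqFinrank]; exact orthonormal_frame hω)

/-- The orthonormal basis `frameBasis` is the frame. [folklore] -/
@[simp]
theorem coe_frameBasis (hω : ‖ω‖ = 1) : ⇑(frameBasis hω) = frame ω := by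
  rw [frameBasis, Module.Basis.coe_toOrthonormalBasis, coe_basisOfOrthonormalOfCardEqFinrank]

/-- Completeness of the frame: `embed ω (coords ω x)` is the orthogonal projection
`x - ⟪ω, x⟫ ω` of `x` onto `ω^⊥` (unit `ω`). [folklore] -/
theorem embed_coords (hω : ‖ω‖ = 1) (x : E³) : embed ω (coords ω x) = x - ⟪ω, x⟫_ℝ • ω := by
  have h := (frameBasis hω).sum_repr' x
  rw [coe_frameBasis, Fin.sum_univ_three] at h
  simp only [frame, Matrix.cons_val_zero, Matrix.cons_val_one, Matrix.cons_val_two,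
    Matrix.head_cons, Matrix.tail_cons] at h
  have h2 : embed ω (coords ω x) = ⟪e₁ ω, x⟫_ℝ • e₁ ω + ⟪e₂ ω, x⟫_ℝ • e₂ ω := by
    simp [embed, coords]
  rw [h2]
  exact eq_sub_of_add_eq h

/-- Pythagoras in the frame: `|coords ω x|² = |x|² - ⟪ω, x⟫²` (unit `ω`). [folklore] -/
theorem norm_sq_coords (hω : ‖ω‖ = 1) (x : E³) : ‖coords ω x‖ ^ 2 = ‖x‖ ^ 2 - ⟪ω, x⟫_ℝ ^ 2 := by
  have h := (frameBasis hω).sum_sq_inner_right x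
  rw [coe_frameBasis, Fin.sum_univ_three] at h
  simp only [frame, Matrix.cons_val_zero, Matrix.cons_val_one, Matrix.cons_val_two,
    Matrix.head_cons, Matrix.tail_cons] at h
  rw [norm_sq_two, ← h]
  simp [coords]

/-- `coords ω` is a left inverse of `embed ω` (unit `ω`). [folklore] -/
@[simp]
theorem coords_embed (hω : ‖ω‖ = 1) (q : E²) : coords ω (embed ω q) = q := by
  ext i
  fin_cases i <;>
    simp [coords, embed, inner_add_right, real_inner_smul_right, norm_e₂ hω, inner_e₁_e₂,
      inner_e₂_e₁]

/-- `coords ω ω = 0`: the normal direction projects to the centre of the disc. [folklore] -/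
@[simp]
theorem coords_self (ω : E³) : coords ω ω = 0 := by
  ext i
  fin_cases i <;> simp [coords, inner_e₁_self, inner_e₂_self]

/-- `coords ω` is linear: scalars. [folklore] -/
theorem coords_smul (ω : E³) (c : ℝ) (x : E³) : coords ω (c • x) = c • coords ω x := by
  ext i
  fin_cases i <;> simp [coords, inner_smul_right]

/-- `coords ω` is linear: sums. [folklore] -/
theorem coords_add (ω x y : E³) : coords ω (x + y) = coords ω x + coords ω y := by
  ext i
  fin_cases i <;> simp [coords, inner_add_right]

/-- `coords ω` is linear: negation. [folklore] -/
theorem coords_neg (ω x : E³) : coords ω (-x) = -coords ω x := by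
  ext i
  fin_cases i <;> simp [coords, inner_neg_right]

/-- Lambert's projection forgets the normal component: `coords ω (x - c ω) = coords ω x`; in
particular the specular reflection `S_ω g = g - 2⟪g, ω⟫ ω` has the same Lambert coordinates as `g`
(this is why `S_ω` is invisible in `lambertPoint`). [folklore] -/
theorem coords_sub_smul_self (ω : E³) (c : ℝ) (x : E³) : coords ω (x - c • ω) = coords ω x := by
  rw [sub_eq_add_neg, coords_add, ← neg_smul, coords_smul, coords_self, smul_zero, add_zero]

/-- `embed ω` is linear: scalars. [folklore] -/
theorem embed_smul (ω : E³) (c : ℝ) (q : E²) : embed ω (c • q) = c • embed ω q := by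
  simp only [embed, PiLp.smul_apply, smul_eq_mul, smul_add, mul_smul]

/-- `embed ω` is linear: negation. [folklore] -/
theorem embed_neg (ω : E³) (q : E²) : embed ω (-q) = -embed ω q := by
  simp only [embed, PiLp.neg_apply, neg_smul, neg_add]

/-- `embed ω` is an isometry `ℝ² → ω^⊥` (unit `ω`). [folklore] -/
theorem norm_embed (hω : ‖ω‖ = 1) (q : E²) : ‖embed ω q‖ = ‖q‖ := by
  have h : ‖embed ω q‖ ^ 2 = ‖q‖ ^ 2 := by
    rw [embed, norm_add_sq_real, real_inner_smul_left, real_inner_smul_right, inner_e₁_e₂,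
      norm_smul, norm_smul, norm_e₁, norm_e₂ hω, Real.norm_eq_abs, Real.norm_eq_abs, mul_one,
      mul_one, sq_abs, sq_abs, norm_sq_two]
    ring
  rw [← Real.sqrt_sq (norm_nonneg (embed ω q)), h, Real.sqrt_sq (norm_nonneg q)]

/-- `embed ω q ⟂ ω`. [folklore] -/
theorem inner_embed_self (ω : E³) (q : E²) : ⟪embed ω q, ω⟫_ℝ = 0 := by
  simp [embed, inner_add_left, real_inner_smul_left, inner_e₁_self, inner_e₂_self]

/-- The lift of a disc point has Lambert coordinates that point (unit `ω`). [folklore] -/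
@[simp]
theorem coords_lift (hω : ‖ω‖ = 1) (q : E²) : coords ω (lift ω q) = q := by
  rw [lift, coords_add, coords_embed hω, coords_smul, coords_self, smul_zero, add_zero]

/-- The normal component of the lift: `⟪lift ω q, ω⟫ = √(1 - |q|²) ≥ 0`, i.e. lifts are
outgoing (unit `ω`). [folklore] -/
theorem inner_lift_self (hω : ‖ω‖ = 1) (q : E²) : ⟪lift ω q, ω⟫_ℝ = √(1 - ‖q‖ ^ 2) := by
  rw [lift, inner_add_left, inner_embed_self, real_inner_smul_left, real_inner_self_eq_norm_sq, hω]
  simp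

/-- The lift of a point of the closed unit disc is a unit vector (unit `ω`). [folklore] -/
theorem norm_lift (hω : ‖ω‖ = 1) {q : E²} (hq : ‖q‖ ≤ 1) : ‖lift ω q‖ = 1 := by
  have hq2 : 0 ≤ 1 - ‖q‖ ^ 2 := by nlinarith [norm_nonneg q]
  have h : ‖lift ω q‖ ^ 2 = 1 := by
    rw [lift, norm_add_sq_real, real_inner_smul_right, inner_embed_self, mul_zero, mul_zero,
      add_zero, norm_smul, hω, mul_one, norm_embed hω, Real.norm_eq_abs, sq_abs, Real.sq_sqrt hq2]
    ring
  have h' := congrArg Real.sqrt h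
  rwa [Real.sqrt_sq (norm_nonneg _), Real.sqrt_one] at h'

end Lambert

/-! ## The diced reflection law of a pair -/

section Reflection

variable {ω : E³}

/-- The LAMBERT POINT of an incoming relative velocity `g` at unit normal `ω`: the Lambert
projection `Λ_ω (S_ω g / |g|) = coords ω g / |g|` of the specular outgoing direction (Lambert's
projection forgets the normal component, so `S_ω` drops out). It lies in the closed unit disc,
in the open disc iff the pair is not grazing (`norm_lambertPoint_lt_one`). Junk `0` at `g = 0`.
[folklore] -/
def lambertPoint (ω g : E³) : E² := ‖g‖⁻¹ • Lambert.coords ω g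

/-- The OUTGOING RELATIVE VELOCITY of the diced rule with disc map `A` (`= D.F θ_i θ_j`):
`g' = |g| · Λ_ω⁻¹ (A (Λ_ω (S_ω g / |g|)))` (route AnosovRotorDice, model clause). [folklore] -/
def dicedRelVel (ω : E³) (A : E² → E²) (g : E³) : E³ :=
  ‖g‖ • Lambert.lift ω (A (lambertPoint ω g))

/-- The DICED REFLECTION of a velocity pair `p = (v, w)` at unit normal `ω` with disc map `A`: keep
the centre-of-mass velocity `c = (v + w)/2` and the relative speed, replace the relative velocity
`g = v - w` by `g' = dicedRelVel ω A g`: `(v', w') = (c + g'/2, c - g'/2)`. For `A = id` and an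
incoming pair this is the elastic law `reflectVel ω` (`dicedReflectVel_id`). [folklore] -/
def dicedReflectVel (ω : E³) (A : E² → E²) (p : E³ × E³) : E³ × E³ :=
  ((2 : ℝ)⁻¹ • (p.1 + p.2) + (2 : ℝ)⁻¹ • dicedRelVel ω A (p.1 - p.2),
    (2 : ℝ)⁻¹ • (p.1 + p.2) - (2 : ℝ)⁻¹ • dicedRelVel ω A (p.1 - p.2))

/-- The Lambert point in the frame: `embed ω (lambertPoint ω g) = (g - ⟪g, ω⟫ ω)/|g|`. [folklore] -/
theorem embed_lambertPoint (hω : ‖ω‖ = 1) (g : E³) :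
    Lambert.embed ω (lambertPoint ω g) = ‖g‖⁻¹ • (g - ⟪g, ω⟫_ℝ • ω) := by
  rw [lambertPoint, Lambert.embed_smul, Lambert.embed_coords hω, real_inner_comm g ω]

/-- `|lambertPoint ω g|² = 1 - (⟪g, ω⟫/|g|)²` for `g ≠ 0`. [folklore] -/
theorem norm_sq_lambertPoint (hω : ‖ω‖ = 1) {g : E³} (h0 : g ≠ 0) :
    ‖lambertPoint ω g‖ ^ 2 = 1 - (⟪g, ω⟫_ℝ / ‖g‖) ^ 2 := by
  have hn : ‖g‖ ≠ 0 := norm_ne_zero_iff.2 h0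
  rw [lambertPoint, norm_smul, norm_inv, norm_norm, mul_pow, Lambert.norm_sq_coords hω,
    real_inner_comm g ω]
  field_simp

/-- The Lambert point lies in the closed unit disc. [folklore] -/
theorem norm_lambertPoint_le_one (hω : ‖ω‖ = 1) (g : E³) : ‖lambertPoint ω g‖ ≤ 1 := by
  by_cases h0 : g = 0
  · simp [lambertPoint, h0]
  have h : ‖lambertPoint ω g‖ ^ 2 ≤ 1 := by
    rw [norm_sq_lambertPoint hω h0]
    linarith [sq_nonneg (⟪g, ω⟫_ℝ / ‖g‖)]
  exact (pow_le_one_iff_of_nonneg (norm_nonneg _) two_ne_zero).1 h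

/-- For a non-grazing pair the Lambert point lies in the OPEN unit disc. [folklore] -/
theorem norm_lambertPoint_lt_one (hω : ‖ω‖ = 1) {g : E³} (hg : ⟪g, ω⟫_ℝ ≠ 0) :
    ‖lambertPoint ω g‖ < 1 := by
  have h0 : g ≠ 0 := fun h => hg (by rw [h, inner_zero_left])
  have hn : 0 < ‖g‖ := norm_pos_iff.2 h0
  have h : ‖lambertPoint ω g‖ ^ 2 < 1 := by
    rw [norm_sq_lambertPoint hω h0]
    have : 0 < (⟪g, ω⟫_ℝ / ‖g‖) ^ 2 := by positivity
    linarith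
  exact (pow_lt_one_iff_of_nonneg (norm_nonneg _) two_ne_zero).1 h

/-- The normal component hidden in the Lambert point of an incoming `g ≠ 0`:
`√(1 - |lambertPoint ω g|²) = -⟪g, ω⟫/|g|`. [folklore] -/
theorem sqrt_one_sub_norm_sq_lambertPoint (hω : ‖ω‖ = 1) {g : E³} (h0 : g ≠ 0)
    (hg : ⟪g, ω⟫_ℝ ≤ 0) : √(1 - ‖lambertPoint ω g‖ ^ 2) = -⟪g, ω⟫_ℝ / ‖g‖ := by
  rw [norm_sq_lambertPoint hω h0, sub_sub_cancel, Real.sqrt_sq_eq_abs, abs_div, abs_norm,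
    abs_of_nonpos hg, neg_div]

/-- The diced rule preserves the relative speed, `|g'| = |g|`, as soon as the die keeps the Lambert
point in the closed disc. [folklore] -/
theorem norm_dicedRelVel (hω : ‖ω‖ = 1) {A : E² → E²} {g : E³}
    (hA : ‖A (lambertPoint ω g)‖ ≤ 1) : ‖dicedRelVel ω A g‖ = ‖g‖ := by
  rw [dicedRelVel, norm_smul, norm_norm, Lambert.norm_lift hω hA, mul_one]

/-- The outgoing pair IS outgoing: `⟪g', ω⟫ = |g| √(1 - |A q|²) ≥ 0`, and `> 0` iff `g ≠ 0` and the
die value lies in the open disc. [folklore] -/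
theorem inner_dicedRelVel (hω : ‖ω‖ = 1) (A : E² → E²) (g : E³) :
    ⟪dicedRelVel ω A g, ω⟫_ℝ = ‖g‖ * √(1 - ‖A (lambertPoint ω g)‖ ^ 2) := by
  rw [dicedRelVel, real_inner_smul_left, Lambert.inner_lift_self hω]

/-- SPECULAR CASE: for the identity die and an incoming (or grazing) `g`, the diced outgoing
relative velocity is the specular reflection `S_ω g = g - 2⟪g, ω⟫ ω`. [folklore] -/
theorem dicedRelVel_id (hω : ‖ω‖ = 1) {g : E³} (hg : ⟪g, ω⟫_ℝ ≤ 0) :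
    dicedRelVel ω id g = g - (2 * ⟪g, ω⟫_ℝ) • ω := by
  by_cases h0 : g = 0
  · simp [dicedRelVel, h0]
  have hn : ‖g‖ ≠ 0 := norm_ne_zero_iff.2 h0
  have hc : ‖g‖ * (-⟪g, ω⟫_ℝ / ‖g‖) = -⟪g, ω⟫_ℝ := by field_simp
  rw [dicedRelVel, id, Lambert.lift, sqrt_one_sub_norm_sq_lambertPoint hω h0 hg,
    embed_lambertPoint hω]
  simp only [smul_add, smul_smul, mul_inv_cancel₀ hn, one_smul, hc]
  module

/-- `F ≡ id` RECOVERS THE HARD-SPHERE GAS: for a unit normal and an incoming (or grazing) pair the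
diced reflection with the identity die is the elastic law `reflectVel` of
`HardSpherePhaseSpace.lean` (GST 2013 (1.1.2)). [cite: GST2013, (1.1.2)] -/
theorem dicedReflectVel_id (hω : ‖ω‖ = 1) {p : E³ × E³} (hp : ⟪p.1 - p.2, ω⟫_ℝ ≤ 0) :
    dicedReflectVel ω id p = reflectVel ω p := by
  rw [dicedReflectVel, dicedRelVel_id hω hp, reflectVel, hω, one_pow, div_one]
  simp only [Prod.mk.injEq]
  constructor <;> module

/-- Conservation of momentum: `v' + w' = v + w`. [folklore] -/
theorem dicedReflectVel_fst_add_snd (ω : E³) (A : E² → E²) (p : E³ × E³) :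
    (dicedReflectVel ω A p).1 + (dicedReflectVel ω A p).2 = p.1 + p.2 := by
  simp only [dicedReflectVel]
  module

/-- Conservation of kinetic energy, `|v'|² + |w'|² = |v|² + |w|²`, for a die keeping the Lambert
point in the closed disc (parallelogram law and `|g'| = |g|`). [folklore] -/
theorem norm_sq_dicedReflectVel (hω : ‖ω‖ = 1) {A : E² → E²} {p : E³ × E³}
    (hA : ‖A (lambertPoint ω (p.1 - p.2))‖ ≤ 1) :
    ‖(dicedReflectVel ω A p).1‖ ^ 2 + ‖(dicedReflectVel ω A p).2‖ ^ 2 =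
      ‖p.1‖ ^ 2 + ‖p.2‖ ^ 2 := by
  have hg := norm_dicedRelVel hω hA
  have key : ∀ c y : E³, ‖c + (2 : ℝ)⁻¹ • y‖ ^ 2 + ‖c - (2 : ℝ)⁻¹ • y‖ ^ 2 =
      2 * ‖c‖ ^ 2 + 2⁻¹ * ‖y‖ ^ 2 := by
    intro c y
    rw [norm_add_sq_real, norm_sub_sq_real, norm_smul, Real.norm_eq_abs,
      abs_of_pos (by norm_num : (0 : ℝ) < 2⁻¹)]
    ring
  have h1 : p.1 = (2 : ℝ)⁻¹ • (p.1 + p.2) + (2 : ℝ)⁻¹ • (p.1 - p.2) := by module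
  have h2 : p.2 = (2 : ℝ)⁻¹ • (p.1 + p.2) - (2 : ℝ)⁻¹ • (p.1 - p.2) := by module
  calc ‖(dicedReflectVel ω A p).1‖ ^ 2 + ‖(dicedReflectVel ω A p).2‖ ^ 2
      = 2 * ‖(2 : ℝ)⁻¹ • (p.1 + p.2)‖ ^ 2 + 2⁻¹ * ‖dicedRelVel ω A (p.1 - p.2)‖ ^ 2 := key _ _
    _ = 2 * ‖(2 : ℝ)⁻¹ • (p.1 + p.2)‖ ^ 2 + 2⁻¹ * ‖p.1 - p.2‖ ^ 2 := by rw [hg]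
    _ = ‖(2 : ℝ)⁻¹ • (p.1 + p.2) + (2 : ℝ)⁻¹ • (p.1 - p.2)‖ ^ 2 +
          ‖(2 : ℝ)⁻¹ • (p.1 + p.2) - (2 : ℝ)⁻¹ • (p.1 - p.2)‖ ^ 2 := (key _ _).symm
    _ = ‖p.1‖ ^ 2 + ‖p.2‖ ^ 2 := by rw [← h1, ← h2]

/-- The Lambert point read backwards: reversing the outgoing relative velocity `g'` of the diced
rule gives an incoming velocity `-g'` whose Lambert point is `-(A q)`, the ANTIPODE of the die
value. [folklore] -/
theorem lambertPoint_neg_dicedRelVel (hω : ‖ω‖ = 1) {A : E² → E²} {g : E³} (h0 : g ≠ 0)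
    (hA : ‖A (lambertPoint ω g)‖ ≤ 1) :
    lambertPoint ω (-dicedRelVel ω A g) = -(A (lambertPoint ω g)) := by
  have hn : ‖g‖ ≠ 0 := norm_ne_zero_iff.2 h0
  rw [lambertPoint, norm_neg, norm_dicedRelVel hω hA, Lambert.coords_neg, dicedRelVel,
    Lambert.coords_smul, Lambert.coords_lift hω, smul_neg, smul_smul, inv_mul_cancel₀ hn, one_smul]

/-- TIME REVERSAL OF THE PAIR RULE. If `g` is incoming, the die `A` keeps its Lambert point `q` in
the closed disc, and the die `A'` read by the reversed motion satisfies `A' (-(A q)) = -q`, then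
dicing the reversed outgoing velocity `-g'` with `A'` returns `-g`. Hence the conjugating
involution of the disc in the reversibility clause of a die is the central inversion `C q = -q`:
`F (ι θ) (ι θ') = C ∘ (F θ θ')⁻¹ ∘ C` (`RotorDie.IsReversible`). [folklore] -/
theorem dicedRelVel_reverse (hω : ‖ω‖ = 1) {A A' : E² → E²} {g : E³} (hg : ⟪g, ω⟫_ℝ ≤ 0)
    (hA : ‖A (lambertPoint ω g)‖ ≤ 1)
    (hA' : A' (-(A (lambertPoint ω g))) = -lambertPoint ω g) :
    dicedRelVel ω A' (-dicedRelVel ω A g) = -g := by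
  by_cases h0 : g = 0
  · subst h0
    simp [dicedRelVel]
  have hn : ‖g‖ ≠ 0 := norm_ne_zero_iff.2 h0
  have hc : ‖g‖ * (-⟪g, ω⟫_ℝ / ‖g‖) = -⟪g, ω⟫_ℝ := by field_simp
  rw [dicedRelVel, norm_neg, norm_dicedRelVel hω hA, lambertPoint_neg_dicedRelVel hω h0 hA, hA',
    Lambert.lift, norm_neg, Lambert.embed_neg, embed_lambertPoint hω,
    sqrt_one_sub_norm_sq_lambertPoint hω h0 hg]
  simp only [smul_add, smul_neg, smul_smul, mul_inv_cancel₀ hn, one_smul, hc]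
  module

/-- TIME REVERSAL OF THE DICED REFLECTION: flipping the velocities of the outgoing pair and dicing
with a die `A'` such that `A' (-(A q)) = -q` returns the flipped incoming pair (CIP 1994 §4.2 for
the elastic case `A = A' = id`). [folklore] -/
theorem dicedReflectVel_reverse (hω : ‖ω‖ = 1) {A A' : E² → E²} {p : E³ × E³}
    (hp : ⟪p.1 - p.2, ω⟫_ℝ ≤ 0) (hA : ‖A (lambertPoint ω (p.1 - p.2))‖ ≤ 1)
    (hA' : A' (-(A (lambertPoint ω (p.1 - p.2)))) = -lambertPoint ω (p.1 - p.2)) :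
    dicedReflectVel ω A' (-(dicedReflectVel ω A p).1, -(dicedReflectVel ω A p).2) =
      (-p.1, -p.2) := by
  have hrev := dicedRelVel_reverse hω hp hA hA'
  set P := dicedReflectVel ω A p with hP
  have e1 : -P.1 - -P.2 = -dicedRelVel ω A (p.1 - p.2) := by
    rw [hP, dicedReflectVel]
    module
  have e2 : -P.1 + -P.2 = -(p.1 + p.2) := by
    rw [hP, dicedReflectVel]
    module
  rw [dicedReflectVel]
  simp only [e1, e2, hrev, Prod.mk.injEq]
  constructor <;> module

end Reflection

/-! ## The diced collision of a pair of spheres -/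

section Pair

variable {X : Type*} {N : ℕ}

/-- The unit contact normal `ω = (x_i - x_j)/|x_i - x_j|` of the pair `(i, j)` (`G.sepVec`,
minimal image on the torus; junk `0` if the separation vanishes). [folklore] -/
def contactNormal (G : Geometry (Fin 3) X) (z : Config N (Fin 3) X) (i j : Fin N) : E³ :=
  ‖G.sepVec (z i).1 (z j).1‖⁻¹ • G.sepVec (z i).1 (z j).1

/-- The DICED COLLISION of the ordered pair `(i, j)` with disc map `A` in the configuration `z`:
positions unchanged, `(v_i, v_j) ↦ dicedReflectVel ω A (v_i, v_j)` with `ω = contactNormal G z i j`,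
all other particles unchanged (cf. `collidePair`, GST 2013 (1.1.2)–(1.1.3)). [folklore] -/
def dicedCollidePair (G : Geometry (Fin 3) X) (i j : Fin N) (A : E² → E²)
    (z : Config N (Fin 3) X) : Config N (Fin 3) X :=
  Function.update (Function.update z i
    ((z i).1, (dicedReflectVel (contactNormal G z i j) A ((z i).2, (z j).2)).1)) j
    ((z j).1, (dicedReflectVel (contactNormal G z i j) A ((z i).2, (z j).2)).2)

variable {G : Geometry (Fin 3) X} {i j : Fin N} {A : E² → E²}

/-- After the diced collision particle `i` has velocity `v_i'`, same position. [folklore] -/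
theorem dicedCollidePair_apply_left (hij : i ≠ j) (z : Config N (Fin 3) X) :
    dicedCollidePair G i j A z i =
      ((z i).1, (dicedReflectVel (contactNormal G z i j) A ((z i).2, (z j).2)).1) := by
  simp [dicedCollidePair, Function.update_of_ne hij]

/-- After the diced collision particle `j` has velocity `v_j'`, same position. [folklore] -/
theorem dicedCollidePair_apply_right (z : Config N (Fin 3) X) :
    dicedCollidePair G i j A z j =
      ((z j).1, (dicedReflectVel (contactNormal G z i j) A ((z i).2, (z j).2)).2) := by
  simp [dicedCollidePair]

/-- Particles other than `i, j` are unaffected. [folklore] -/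
theorem dicedCollidePair_apply_of_ne {k : Fin N} (hki : k ≠ i) (hkj : k ≠ j)
    (z : Config N (Fin 3) X) : dicedCollidePair G i j A z k = z k := by
  simp [dicedCollidePair, Function.update_of_ne hki, Function.update_of_ne hkj]

/-- A diced collision does not move the particles. [folklore] -/
@[simp]
theorem dicedCollidePair_apply_fst (z : Config N (Fin 3) X) (k : Fin N) :
    (dicedCollidePair G i j A z k).1 = (z k).1 := by
  by_cases hkj : k = j
  · subst hkj; rw [dicedCollidePair_apply_right]
  by_cases hki : k = i
  · subst hki; rw [dicedCollidePair_apply_left hkj]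
  rw [dicedCollidePair_apply_of_ne hki hkj]

/-- Diced collisions preserve the hard-sphere domain (positions do not move). [folklore] -/
theorem dicedCollidePair_mem_hardSphereDomain_iff {ε : ℝ} (z : Config N (Fin 3) X) :
    dicedCollidePair G i j A z ∈ hardSphereDomain G N ε ↔ z ∈ hardSphereDomain G N ε := by
  simp [mem_hardSphereDomain]

/-- `F ≡ id` RECOVERS `collidePair`: for an incoming pair the diced collision with the identity die
is the elastic collision of `HardSpherePhaseSpace.lean`. [cite: GST2013, (1.1.2)] -/
theorem dicedCollidePair_id (hij : i ≠ j) {z : Config N (Fin 3) X} (hz : IsIncoming G z i j) :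
    dicedCollidePair G i j id z = collidePair G i j z := by
  set n := G.sepVec (z i).1 (z j).1 with hn
  have hn0 : n ≠ 0 := by
    intro h
    simp [IsIncoming, ← hn, h] at hz
  have hnn : ‖n‖ ≠ 0 := norm_ne_zero_iff.2 hn0
  have hω : ‖contactNormal G z i j‖ = 1 := by
    rw [contactNormal, ← hn, norm_smul, norm_inv, norm_norm, inv_mul_cancel₀ hnn]
  have hp : ⟪(z i).2 - (z j).2, contactNormal G z i j⟫_ℝ ≤ 0 := by
    rw [contactNormal, ← hn, real_inner_smul_right, real_inner_comm]
    exact mul_nonpos_of_nonneg_of_nonpos (inv_nonneg.2 (norm_nonneg n)) hz.le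
  have key : dicedReflectVel (contactNormal G z i j) id ((z i).2, (z j).2) =
      reflectVel n ((z i).2, (z j).2) := by
    rw [dicedReflectVel_id hω hp, contactNormal, ← hn, reflectVel_smul (inv_ne_zero hnn)]
  funext k
  by_cases hkj : k = j
  · subst hkj
    rw [dicedCollidePair_apply_right, collidePair_apply_right, key]
  by_cases hki : k = i
  · subst hki
    rw [dicedCollidePair_apply_left hkj, collidePair_apply_left hkj, key]
  rw [dicedCollidePair_apply_of_ne hki hkj, collidePair_apply_of_ne hki hkj]

end Pair

/-! ## Dice, diced configurations and diced trajectories -/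

section Die

/-- The dynamical data of a SCATTERING DIE on a measurable rotor space `K` (route AnosovRotorDice,
definition requests D1/D2): a reference measure `m` on `K` (rotor Liouville measure), the rotor
flow `g : ℝ → K → K`, the die map `F θ θ' : ℝ² → ℝ²` read at a contact of rotors `θ, θ'` (meant:
an area-preserving bijection of the closed unit Lambert disc, identity near the circle) and the
rotor involution `ι` (time reversal). No axioms: the hyperbolicity / measure-preservation /
full-support properties live in the interface `AnosovDie` (`Literature/Dynamics/Hyperbolic`) and
in the hypotheses of the statements; this is exactly what the dynamics consumes. [folklore] -/
structure RotorDie (K : Type*) [MeasurableSpace K] where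
  /-- The rotor reference measure (invariant probability of the rotor flow). -/
  m : Measure K
  /-- The rotor flow `θ ↦ g t θ`. -/
  g : ℝ → K → K
  /-- The die: for rotor states `θ, θ'`, a self-map of the Lambert disc `{q ∈ ℝ² | |q| ≤ 1}`. -/
  F : K → K → EuclideanSpace ℝ (Fin 2) → EuclideanSpace ℝ (Fin 2)
  /-- The rotor involution reversing the rotor flow (time reversal). -/
  ι : K → K

variable {K : Type*} [MeasurableSpace K]

/-- The REVERSIBILITY CLAUSE of a die: `ι` is an involution conjugating `g t` to `g (-t)`, and the
die read by reversed rotors undoes the die up to the central inversion `C q = -q` of the disc,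
`F (ι θ) (ι θ') (-(F θ θ' q)) = -q` on the closed disc — the symmetry under which the diced flow is
reversible for `(v, θ) ↦ (-v, ι θ)` (`dicedReflectVel_reverse`). [folklore] -/
structure RotorDie.IsReversible (D : RotorDie K) : Prop where
  /-- `ι` is an involution. -/
  ι_ι : ∀ θ, D.ι (D.ι θ) = θ
  /-- `ι` reverses the rotor flow. -/
  ι_g : ∀ t θ, D.ι (D.g t θ) = D.g (-t) (D.ι θ)
  /-- The die symmetry with `C = -id`. -/
  F_rev : ∀ θ θ' (q : EuclideanSpace ℝ (Fin 2)), ‖q‖ ≤ 1 → D.F (D.ι θ) (D.ι θ') (-(D.F θ θ' q)) = -q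

/-- The DICED PHASE SPACE: hard-sphere configurations in `ℝ³`-velocity geometry together with one
rotor state per sphere, `(x_i, v_i)_{i<N} × (θ_i)_{i<N}`. [folklore] -/
abbrev DicedConfig (N : ℕ) (X : Type*) (K : Type*) := Config N (Fin 3) X × (Fin N → K)

variable {X : Type*} {N : ℕ}

/-- Free motion of the rotors at speed `Ω` for time `t`: `θ_k ↦ D.g (Ω t) θ_k`. [folklore] -/
def rotorFlight (D : RotorDie K) (Ω t : ℝ) (θ : Fin N → K) : Fin N → K :=
  fun k => D.g (Ω * t) (θ k)

/-- Unfolding lemma for `rotorFlight`. [folklore] -/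
@[simp]
theorem rotorFlight_apply (D : RotorDie K) (Ω t : ℝ) (θ : Fin N → K) (k : Fin N) :
    rotorFlight D Ω t θ k = D.g (Ω * t) (θ k) := rfl

/-- Free flight of a diced configuration: centres by `freeFlight`, rotors by `rotorFlight`.
[folklore] -/
def dicedFreeFlight (G : Geometry (Fin 3) X) (D : RotorDie K) (Ω t : ℝ) (z : DicedConfig N X K) :
    DicedConfig N X K :=
  (freeFlight G t z.1, rotorFlight D Ω t z.2)

/-- The diced collision of the ordered pair `(i, j)` of a diced configuration: the die read at the
current rotor states, `dicedCollidePair G i j (D.F θ_i θ_j)`, rotors untouched. [folklore] -/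
def dicedCollide (G : Geometry (Fin 3) X) (D : RotorDie K) (i j : Fin N) (z : DicedConfig N X K) :
    DicedConfig N X K :=
  (dicedCollidePair G i j (D.F (z.2 i) (z.2 j)) z.1, z.2)

/-- A diced collision does not touch the rotors. [folklore] -/
@[simp]
theorem dicedCollide_snd (G : Geometry (Fin 3) X) (D : RotorDie K) (i j : Fin N)
    (z : DicedConfig N X K) : (dicedCollide G D i j z).2 = z.2 := rfl

variable [TopologicalSpace X]

/-- `γ : ℝ → DicedConfig N X K` is a DICED HARD-SPHERE TRAJECTORY of `N` spheres of diameter `ε`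
with die `D` run at rotor speed `Ω` (the route's `HS_rot(Ω, D)`; structure of GST 2013 Def. 4.1.2
as in `IsHardSphereTrajectory`): the translational part stays in `D_ε^N`, has locally finitely many
collision times and continuous positions and is free flight on collision-free intervals `(s, t]`;
the rotors follow `θ(t) = D.g (Ω (t - s)) θ(s)` for all `s ≤ t` (autonomous, untouched at
contacts); at a collision time exactly one pair `i < j` is in contact, the left limit `z⁻` of the
translational part exists and is incoming (no grazing), and the value is the diced collision
`dicedCollidePair G i j (D.F θ_i(t) θ_j(t)) z⁻` (right-continuous convention).
[cite: GST2013, §4.1 Def. 4.1.2] -/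
structure IsDicedHardSphereTrajectory (G : Geometry (Fin 3) X) (ε : ℝ) (N : ℕ) (D : RotorDie K)
    (Ω : ℝ) (γ : ℝ → DicedConfig N X K) : Prop where
  /-- The translational part stays in the hard-sphere domain `D_ε^N`. -/
  mem : ∀ t, (γ t).1 ∈ hardSphereDomain G N ε
  /-- Collision times are locally finite. -/
  locFinite : ∀ a b, (collisionTimes G ε (fun t => (γ t).1) ∩ Icc a b).Finite
  /-- Positions are continuous in time. -/
  pos_continuous : ∀ i, Continuous fun t => ((γ t).1 i).1
  /-- Free flight of the centres on collision-free intervals `(s, t]`. -/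
  free : ∀ s t, s ≤ t → (∀ τ ∈ Ioc s t, τ ∉ collisionTimes G ε (fun t => (γ t).1)) →
    (γ t).1 = freeFlight G (t - s) (γ s).1
  /-- The rotors move autonomously by the rotor flow at speed `Ω`. -/
  rotor : ∀ s t, s ≤ t → (γ t).2 = rotorFlight D Ω (t - s) (γ s).2
  /-- At a collision time a single ordered pair `i < j` collides, from an incoming left limit, by
  the diced law read at the current rotor states. -/
  binary : ∀ t (i j : Fin N), i < j → (γ t).1 ∈ contactSet G N ε i j →
    (∀ i' j' : Fin N, i' < j' → (γ t).1 ∈ contactSet G N ε i' j' → i' = i ∧ j' = j) ∧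
    ∃ zl, Tendsto (fun τ => (γ τ).1) (𝓝[<] t) (𝓝 zl) ∧ IsIncoming G zl i j ∧
      (γ t).1 = dicedCollidePair G i j (D.F ((γ t).2 i) ((γ t).2 j)) zl

/-- The TIME REVERSAL of a diced path: flip the velocities of the left limit of the translational
part at `-t` (restoring right-continuity, as `timeReverse`) and reverse the rotors by `ι`
(CIP 1994 §4.2 for the elastic gas). [cite: CIP1994, §4.2] -/
def dicedTimeReverse (D : RotorDie K) (γ : ℝ → DicedConfig N X K) (t : ℝ) : DicedConfig N X K :=
  (flipVel (Function.leftLim (fun τ => (γ τ).1) (-t)), fun k => D.ι ((γ (-t)).2 k))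

end Die

/-! ## The diced hard-sphere flow (hypothesis structure) -/

section Flow

variable {K : Type*} [MeasurableSpace K] {X : Type*} [MeasureSpace X] {N : ℕ}

/-- A law on configurations with INDEPENDENT ROTORS attached: `P ⊗ m^{⊗N}` (e.g. the local Gibbs
law `⊗ m^{⊗N}`, the reference law of the route's `RotorGasEulerLimit`). [folklore] -/
def withRotors (D : RotorDie K) (P : Measure (Config N (Fin 3) X)) : Measure (DicedConfig N X K) :=
  P.prod (Measure.pi fun _ : Fin N => D.m)

/-- The DICED LIOUVILLE MEASURE `liouville G N ε ⊗ m^{⊗N}`: Lebesgue measure on `D_ε^N` times the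
product of the rotor reference measures. [folklore] -/
def dicedLiouville (G : Geometry (Fin 3) X) (N : ℕ) (ε : ℝ) (D : RotorDie K) :
    Measure (DicedConfig N X K) :=
  withRotors D (liouville G N ε)

/-- Unfolding lemma for the diced Liouville measure. [folklore] -/
theorem dicedLiouville_eq (G : Geometry (Fin 3) X) (N : ℕ) (ε : ℝ) (D : RotorDie K) :
    dicedLiouville G N ε D = (liouville G N ε).prod (Measure.pi fun _ : Fin N => D.m) := rfl

variable [TopologicalSpace X]

/-- The global DICED HARD-SPHERE FLOW `HS_rot(Ω, D)` of `N` spheres of diameter `ε` in the geometry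
`G`, bundled with its defining properties exactly as `HardSphereFlow` (Alexander 1975; GST 2013
Prop. 4.1.1): a measurable, invariant, `dicedLiouville`-conull good set of initial data inside
`D_ε^N × K^N` on which `flow` is a one-parameter group of diced hard-sphere trajectories, each
`flow t` measurable and preserving `liouville ⊗ m^{⊗N}`. Outside `good` the values are junk. Its
existence (for `𝕋³`, `0 < ε < 1/2`, admissible dice) is a separate statement of the route, not a
field. [cite: Alexander1975] -/
structure DicedHardSphereFlow (G : Geometry (Fin 3) X) (ε : ℝ) (N : ℕ) (D : RotorDie K)
    (Ω : ℝ) where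
  /-- The flow map `(t, z) ↦ Φ_t z`. -/
  flow : ℝ → DicedConfig N X K → DicedConfig N X K
  /-- The good set of initial data on which the dynamics is globally defined. -/
  good : Set (DicedConfig N X K)
  /-- The good set is measurable. -/
  measurableSet_good : MeasurableSet good
  /-- The good set lies over the hard-sphere domain. -/
  good_subset : good ⊆ hardSphereDomain G N ε ×ˢ univ
  /-- The good set has full `liouville ⊗ m^{⊗N}` measure. -/
  measure_compl_good : dicedLiouville G N ε D goodᶜ = 0
  /-- The good set is invariant under the flow. -/
  mapsTo_good : ∀ t, MapsTo (flow t) good good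
  /-- `Φ_0 = id` on the good set. -/
  flow_zero : ∀ z ∈ good, flow 0 z = z
  /-- The group property `Φ_{s+t} = Φ_s ∘ Φ_t` on the good set. -/
  flow_add : ∀ s t, ∀ z ∈ good, flow (s + t) z = flow s (flow t z)
  /-- Each time-`t` map is measurable. -/
  measurable_flow : ∀ t, Measurable (flow t)
  /-- Orbits of good points are diced hard-sphere trajectories. -/
  isTrajectory : ∀ z ∈ good, IsDicedHardSphereTrajectory G ε N D Ω fun t => flow t z
  /-- Each time-`t` map preserves `liouville ⊗ m^{⊗N}` (flux preservation of the diced collision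
  map through the Lambert disc). -/
  measurePreserving :
    ∀ t, MeasurePreserving (flow t) (dicedLiouville G N ε D) (dicedLiouville G N ε D)

namespace DicedHardSphereFlow

variable {G : Geometry (Fin 3) X} {ε : ℝ} {D : RotorDie K} {Ω : ℝ}

/-- A diced flow coerces to its flow map. [folklore] -/
instance instCoeFun : CoeFun (DicedHardSphereFlow G ε N D Ω)
    fun _ => ℝ → DicedConfig N X K → DicedConfig N X K :=
  ⟨DicedHardSphereFlow.flow⟩

/-- Almost every initial datum is good. [folklore] -/
theorem ae_mem_good (Φ : DicedHardSphereFlow G ε N D Ω) :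
    ∀ᵐ z ∂dicedLiouville G N ε D, z ∈ Φ.good :=
  Φ.measure_compl_good

/-- The translational configuration at time `t` (forget the rotors): the argument of the empirical
density / momentum / energy fields of `HardSphereEuler.lean`. [folklore] -/
def configFlow (Φ : DicedHardSphereFlow G ε N D Ω) (t : ℝ) (z : DicedConfig N X K) :
    Config N (Fin 3) X :=
  (Φ.flow t z).1

/-- `configFlow` is measurable. [folklore] -/
theorem measurable_configFlow (Φ : DicedHardSphereFlow G ε N D Ω) (t : ℝ) :
    Measurable (Φ.configFlow t) :=
  (Φ.measurable_flow t).fst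

/-- Transport of an extended nonnegative density along the flow, `(S_t W) z = W (Φ_{-t} z)`.
[folklore] -/
def transportDensity (Φ : DicedHardSphereFlow G ε N D Ω) (W : DicedConfig N X K → ℝ≥0∞) (t : ℝ) :
    DicedConfig N X K → ℝ≥0∞ :=
  fun z => W (Φ.flow (-t) z)

/-- Transport of a real function along the flow, `(S_t W) z = W (Φ_{-t} z)`. [folklore] -/
def transportFn (Φ : DicedHardSphereFlow G ε N D Ω) (W : DicedConfig N X K → ℝ) (t : ℝ) :
    DicedConfig N X K → ℝ :=
  fun z => W (Φ.flow (-t) z)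

/-- Unfolding lemma for `transportDensity`. [folklore] -/
@[simp]
theorem transportDensity_apply (Φ : DicedHardSphereFlow G ε N D Ω) (W : DicedConfig N X K → ℝ≥0∞)
    (t : ℝ) (z : DicedConfig N X K) : Φ.transportDensity W t z = W (Φ.flow (-t) z) := rfl

/-- Unfolding lemma for `transportFn`. [folklore] -/
@[simp]
theorem transportFn_apply (Φ : DicedHardSphereFlow G ε N D Ω) (W : DicedConfig N X K → ℝ) (t : ℝ)
    (z : DicedConfig N X K) : Φ.transportFn W t z = W (Φ.flow (-t) z) := rfl

/-- The law at time `t` of the diced system started from the law `P₀`: `(Φ_t)_* P₀`. [folklore] -/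
def lawAt (Φ : DicedHardSphereFlow G ε N D Ω) (P₀ : Measure (DicedConfig N X K)) (t : ℝ) :
    Measure (DicedConfig N X K) :=
  P₀.map (Φ.flow t)

/-- Unfolding lemma for `lawAt`. [folklore] -/
@[simp]
theorem lawAt_eq (Φ : DicedHardSphereFlow G ε N D Ω) (P₀ : Measure (DicedConfig N X K)) (t : ℝ) :
    Φ.lawAt P₀ t = P₀.map (Φ.flow t) := rfl

/-- On the good set `Φ_{-t}` inverts `Φ_t`. [folklore] -/
theorem flow_neg_flow (Φ : DicedHardSphereFlow G ε N D Ω) (t : ℝ) {z : DicedConfig N X K}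
    (hz : z ∈ Φ.good) : Φ.flow (-t) (Φ.flow t z) = z := by
  rw [← Φ.flow_add (-t) t z hz, neg_add_cancel, Φ.flow_zero z hz]

/-- Invariance of `liouville ⊗ m^{⊗N}`: its law at time `t` is itself. [folklore] -/
theorem lawAt_dicedLiouville (Φ : DicedHardSphereFlow G ε N D Ω) (t : ℝ) :
    Φ.lawAt (dicedLiouville G N ε D) t = dicedLiouville G N ε D :=
  (Φ.measurePreserving t).map_eq

/-- Good initial data lie over the hard-sphere domain. [folklore] -/
theorem fst_mem_hardSphereDomain (Φ : DicedHardSphereFlow G ε N D Ω) {z : DicedConfig N X K}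
    (hz : z ∈ Φ.good) : z.1 ∈ hardSphereDomain G N ε :=
  (Φ.good_subset hz).1

/-- Along a good orbit the rotors are the autonomous rotor flow: `(Φ_t z).2 = rotorFlight D Ω t z.2`
for `t ≥ 0`. [folklore] -/
theorem flow_snd_eq (Φ : DicedHardSphereFlow G ε N D Ω) {z : DicedConfig N X K} (hz : z ∈ Φ.good)
    {t : ℝ} (ht : 0 ≤ t) : (Φ.flow t z).2 = rotorFlight D Ω t z.2 := by
  have h := (Φ.isTrajectory z hz).rotor 0 t ht
  simp only [sub_zero, Φ.flow_zero z hz] at h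
  exact h

end DicedHardSphereFlow

end Flow

end

end Literature.Analysis.FluidPDE
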